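import Mathlib
import Literature.Computability.AlgebraicComplexity.StandardFamilies
import Literature.Computability.AlgebraicComplexity.StandardFamiliesProofs
import Literature.LinearAlgebra.Matrix.MvPolynomialDetDegree
import Summits.ValiantsHypothesis.ValiantsHypothesis.Theorems.RefutationDegreeDefs
import Summits.ValiantsHypothesis.ValiantsHypothesis.Theorems.RefutationDegreeRefutationBarrierPencilCoeff
import Summits.ValiantsHypothesis.ValiantsHypothesis.Theorems.RefutationDegreeBeyondHessianNsKernelPlane
import Summits.ValiantsHypothesis.ValiantsHypothesis.Theorems.RefutationDegreeRefutationBarrierStubEventuallyExistsRootNear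
import Summits.ValiantsHypothesis.ValiantsHypothesis.Theorems.RefutationDegreeRefutationBarrierStubExistsSubmoduleLimit
import Summits.ValiantsHypothesis.ValiantsHypothesis.Theorems.RefutationDegreeRefutationBarrierStubTendstoEvalOfTendstoCoeff
import Summits.ValiantsHypothesis.ValiantsHypothesis.Theorems.RefutationDegreeRefutationBarrierStubExistsKernelFlat

/-!
# Route `RefutationDegree`, crux `RefutationBarrier`, line `Sketch_ideator4` (idea `fano-by-one-border`) —
L1: the BORDER-ROBUST KERNEL PLANE

If `per_n` is a coefficientwise limit of determinants of size-`m` affine pencils (`InBorder n m`, the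
route's affine border membership), then through EVERY zero `y` of `per_n` there is an affine flat
`y + W ⊆ {per_n = 0}` with `dim W ≥ n² − m` (registered stub `stub_borderKernelPlane` of the lead
skeleton `Cruxes/RefutationBarrier/Lines/Sketch_ideator4.lean`).

Proof (assembly of the four landed L1 stubs): write `f_k = det A_k(x)` for the approximants
(`coeff_μ f_k → coeff_μ per_n`, all of total degree `≤ m`); restrict to a complex line `t ↦ t•w + y`
on which `per_n` is not identically zero; by `stub_eventually_exists_root_near` (minimum modulus) and
`stub_tendsto_eval_of_tendsto_coeff` (joint continuity) a subsequence `f_{φ j}` has zeros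
`z_j = t_j • w + y → y`; by `stub_exists_kernelFlat` each `f_{φ j}` vanishes on a flat `z_j + K_j`,
`dim K_j ≥ n² − m`; by `stub_exists_submodule_limit` (Grassmannian compactness, transported to
`EuclideanSpace`) a further subsequence of the `K_j` converges to some `W`, `dim W ≥ n² − m`, every
`w ∈ W` being a limit of `u_i ∈ K_{ψ i}`; finally `per_n(y + w) = lim f(z + u) = lim 0 = 0` by joint
continuity again.

References: Landsberg–Manivel–Ressayre 2013 (border determinantal complexity); the kernel-plane
argument is the border version of Mignon–Ressayre 2004 / von zur Gathen 1987 (exact pencils: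
`RefutationDegreeBeyondHessianNsKernelPlane`).
-/

set_option linter.dupNamespace false

noncomputable section

namespace Summit.ValiantsHypothesis.ValiantsHypothesis.Theorems.RefutationDegree

open scoped BigOperators
open Filter Topology MvPolynomial
open Literature.Computability.AlgebraicComplexity (perPoly perPoly_ne_zero)
open Summit.ValiantsHypothesis.ValiantsHypothesis.Theorems.RefutationDegreeBeyondHessianNs (eval_aeval_line)

/-- The `k`-th APPROXIMANT of a border sequence: the determinant of the generic pencil with its
unknowns evaluated at the complex point `a`, a polynomial in the `n²` variables `x`. [folklore] -/
private theorem totalDegree_approximant_le {n m : ℕ} (a : Unk n m → ℂ) :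
    (MvPolynomial.map (eval a) (pencil n m).det).totalDegree ≤ m := by
  classical
  rw [RingHom.map_det, RingHom.mapMatrix_apply]
  have h := Literature.LinearAlgebra.Matrix.totalDegree_det_le
    ((pencil n m).map (MvPolynomial.map (eval a))) (fun _ => 1) (fun i j => ?_)
  · simpa using h
  · simp only [Matrix.map_apply, pencil, Matrix.of_apply, map_add, map_sum, map_mul, map_X, map_C]
    refine (totalDegree_add _ _).trans (max_le ?_ ?_)
    · rw [totalDegree_C]
      exact Nat.zero_le _
    · refine totalDegree_finsetSum_le fun e _ => (totalDegree_mul _ _).trans ?_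
      rw [totalDegree_C, add_zero, totalDegree_X]

/-- The coefficients of the approximants: `eval a (P.coeff μ) = coeff_μ (det A_a) − coeff_μ per_n`.
[folklore] -/
private theorem coeff_approximant {n m : ℕ} (a : Unk n m → ℂ) (μ : (Fin n × Fin n) →₀ ℕ) :
    (MvPolynomial.map (eval a) (pencil n m).det).coeff μ =
      eval a ((defect n m).coeff μ) + (perPoly (Fin n) ℂ).coeff μ := by
  rw [coeff_defect, map_sub, eval_C, coeff_map, sub_add_cancel]

/-- **L1 — the border-robust kernel plane** (registered stub `stub_borderKernelPlane` of line
`Sketch_ideator4`).  If `per_n` is a coefficientwise limit of determinants of size-`m` affine pencils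
(`InBorder n m`), then through every zero `y` of `per_n` there is an affine flat `y + W ⊆ {per_n = 0}`
with `dim W ≥ n² − m`. [folklore] -/
theorem stub_borderKernelPlane {n m : ℕ} (h : InBorder n m) (y : Fin n × Fin n → ℂ)
    (hy : eval y (perPoly (Fin n) ℂ) = 0) :
    ∃ W : Submodule ℂ (Fin n × Fin n → ℂ), n ^ 2 ≤ Module.finrank ℂ W + m ∧
      ∀ w ∈ W, eval (y + w) (perPoly (Fin n) ℂ) = 0 := by
  classical
  obtain ⟨A, hA⟩ := h
  -- the approximants and their coefficientwise convergence to `per_n`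
  set per := perPoly (Fin n) ℂ with hper
  set f : ℕ → MvPolynomial (Fin n × Fin n) ℂ :=
    fun k => MvPolynomial.map (eval (A k)) (pencil n m).det with hf
  have hdeg : ∀ k, (f k).totalDegree ≤ m := fun k => totalDegree_approximant_le (A k)
  have hcoeff : ∀ μ, Tendsto (fun k => (f k).coeff μ) atTop (𝓝 (per.coeff μ)) := by
    intro μ
    have h1 : (fun k => (f k).coeff μ) = fun k => eval (A k) ((defect n m).coeff μ) + per.coeff μ := by
      funext k
      exact coeff_approximant (A k) μ
    rw [h1]
    simpa using (hA μ).add_const (per.coeff μ)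
  -- joint continuity along any subsequence
  have hjoint : ∀ φ : ℕ → ℕ, StrictMono φ → ∀ (x : ℕ → Fin n × Fin n → ℂ) (x₀ : Fin n × Fin n → ℂ),
      Tendsto x atTop (𝓝 x₀) → Tendsto (fun i => eval (x i) (f (φ i))) atTop (𝓝 (eval x₀ per)) :=
    fun φ hφ x x₀ hx =>
      stub_tendsto_eval_of_tendsto_coeff (fun i => f (φ i)) per (fun i => hdeg (φ i))
        (fun μ => (hcoeff μ).comp hφ.tendsto_atTop) x x₀ hx
  -- a direction `w` with `per_n (w + y) ≠ 0`
  obtain ⟨x₁, hx₁⟩ : ∃ x₁ : Fin n × Fin n → ℂ, eval x₁ per ≠ 0 := by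
    by_contra hno
    push Not at hno
    exact perPoly_ne_zero (Fin n) ℂ (MvPolynomial.funext fun x => by rw [hno x, map_zero])
  set w : Fin n × Fin n → ℂ := x₁ - y with hw
  -- the univariate restrictions
  set line : Fin n × Fin n → Polynomial ℂ :=
    fun e => Polynomial.C (w e) * Polynomial.X + Polynomial.C (y e) with hline
  set q : Polynomial ℂ := aeval line per with hq
  set p : ℕ → ℂ → ℂ := fun k t => Polynomial.eval t (aeval line (f k)) with hp
  have hp_eval : ∀ k t, p k t = eval (t • w + y) (f k) := fun k t => eval_aeval_line (f k) w y t
  have hq_eval : ∀ t, q.eval t = eval (t • w + y) per := fun t => eval_aeval_line per w y t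
  have hp_diff : ∀ k, Differentiable ℂ (p k) := fun k => Polynomial.differentiable _
  have hq_ne : q ≠ 0 := by
    intro h0
    apply hx₁
    have := hq_eval 1
    rw [h0, Polynomial.eval_zero, one_smul, hw, sub_add_cancel] at this
    exact this.symm
  have hq0 : q.eval 0 = 0 := by rw [hq_eval, zero_smul, zero_add, hy]
  have hlin : ∀ (t : ℕ → ℂ) (t₀ : ℂ), Tendsto t atTop (𝓝 t₀) →
      Tendsto (fun i => t i • w + y) atTop (𝓝 (t₀ • w + y)) := fun t t₀ ht =>
    (ht.smul_const w).add_const y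
  have hcc : ∀ φ : ℕ → ℕ, StrictMono φ → ∀ (t : ℕ → ℂ) (t₀ : ℂ), Tendsto t atTop (𝓝 t₀) →
      Tendsto (fun i => p (φ i) (t i)) atTop (𝓝 (q.eval t₀)) := by
    intro φ hφ t t₀ ht
    simp only [hp_eval, hq_eval]
    exact hjoint φ hφ _ _ (hlin t t₀ ht)
  -- zeros of a subsequence of approximants converging to `y`
  have hroots : ∀ j : ℕ, ∀ᶠ k in atTop, ∃ t : ℂ, ‖t‖ < 1 / ((j : ℝ) + 1) ∧ p k t = 0 := fun j =>
    stub_eventually_exists_root_near p q hp_diff hcc hq_ne hq0 Nat.one_div_pos_of_nat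
  obtain ⟨φ, hφ, hφroot⟩ := extraction_forall_of_eventually hroots
  choose t ht_norm ht_root using hφroot
  have ht0 : Tendsto t atTop (𝓝 0) :=
    squeeze_zero_norm (fun j => (ht_norm j).le) tendsto_one_div_add_atTop_nhds_zero_nat
  set z : ℕ → Fin n × Fin n → ℂ := fun j => t j • w + y with hz
  have hz_lim : Tendsto z atTop (𝓝 y) := by
    have := hlin t 0 ht0
    rwa [zero_smul, zero_add] at this
  have hz_root : ∀ j, eval (z j) (f (φ j)) = 0 := fun j => by
    rw [hz, ← hp_eval]; exact ht_root j
  -- exact kernel flats of the approximants at these zeros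
  have hflat : ∀ j, ∃ K : Submodule ℂ (Fin n × Fin n → ℂ), n ^ 2 ≤ Module.finrank ℂ K + m ∧
      ∀ v ∈ K, eval (z j + v) (f (φ j)) = 0 := fun j =>
    stub_exists_kernelFlat (A (φ j)) (z j) (hz_root j)
  choose K hK_dim hK_zero using hflat
  -- Grassmannian compactness, in the Euclidean model of `ℂ^{n²}`
  set e : EuclideanSpace ℂ (Fin n × Fin n) ≃L[ℂ] (Fin n × Fin n → ℂ) :=
    EuclideanSpace.equiv (Fin n × Fin n) ℂ with he
  set K' : ℕ → Submodule ℂ (EuclideanSpace ℂ (Fin n × Fin n)) :=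
    fun j => (K j).map (e.symm.toLinearEquiv : (Fin n × Fin n → ℂ) →ₗ[ℂ] _) with hK'
  have hK'_dim : ∀ j, n ^ 2 - m ≤ Module.finrank ℂ (K' j) := fun j => by
    have h1 : Module.finrank ℂ (K' j) = Module.finrank ℂ (K j) :=
      LinearEquiv.finrank_map_eq e.symm.toLinearEquiv (K j)
    have h2 := hK_dim j
    omega
  obtain ⟨W', ψ, hψ, hW'_dim, hW'_lim⟩ := stub_exists_submodule_limit (n ^ 2 - m) K' hK'_dim
  refine ⟨W'.map (e.toLinearEquiv : _ →ₗ[ℂ] (Fin n × Fin n → ℂ)), ?_, ?_⟩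
  · have h1 : Module.finrank ℂ (W'.map (e.toLinearEquiv : _ →ₗ[ℂ] (Fin n × Fin n → ℂ))) =
        Module.finrank ℂ W' := LinearEquiv.finrank_map_eq e.toLinearEquiv W'
    omega
  · intro w hw
    obtain ⟨w', hw', rfl⟩ := Submodule.mem_map.mp hw
    obtain ⟨v, hv_mem, hv_lim⟩ := hW'_lim w' hw'
    -- back in `ℂ^{n²}`: `u i := e (v i) ∈ K (ψ i)`, `u i → e w'`
    have hu_mem : ∀ i, e (v i) ∈ K (ψ i) := fun i => by
      obtain ⟨u, hu, hu'⟩ := Submodule.mem_map.mp (hv_mem i)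
      have : e (v i) = u := by
        rw [← hu']
        exact e.apply_symm_apply u
      rw [this]
      exact hu
    have hu_lim : Tendsto (fun i => z (ψ i) + e (v i)) atTop (𝓝 (y + e w')) :=
      (hz_lim.comp hψ.tendsto_atTop).add ((e.continuous.tendsto w').comp hv_lim)
    have hlim := hjoint (φ ∘ ψ) (hφ.comp hψ) _ _ hu_lim
    have hzero : (fun i => eval (z (ψ i) + e (v i)) (f ((φ ∘ ψ) i))) = fun _ => 0 := by
      funext i
      exact hK_zero (ψ i) _ (hu_mem i)
    rw [hzero] at hlim
    exact (tendsto_nhds_unique tendsto_const_nhds hlim).symm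

end Summit.ValiantsHypothesis.ValiantsHypothesis.Theorems.RefutationDegree

end
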